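import Literature.AlgebraicGeometry.Frobenioids.ArchimedeanClausesC
import HarnessLib

/-!
# Frobenioids II, Example 3.3 (ii): [FrdI] Def. 1.3 (iii)(d) for `C₀` — co-angular pre-steps vs `Φ₀`

Mochizuki, *The geometry of Frobenioids II: poly-Frobenioids*, Kyushu J. Math. **62** (2008)
401–460, §3, Example 3.3 (ii), author's text p. 28 [cite: MochizukiFrdII2008, Ex 3.3 (ii) p.28];
clause (iii)(d) of [FrdI] Def. 1.3 (found's `Frobenioid.lean`) for abc-iut-L1-t6's `C₀ → F_{Φ₀}`.
PROOF-ONLY file (no definition).  The co-angular pre-steps out of (resp. into) an object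
`A = (K, B, λ)` are, up to isomorphism, the arrows `(𝟙, 1, 1) : (K, B, λ) → (K, B, λ e^x)` (resp.
`(K, B, λ e^{-x}) → (K, B, λ)`), `x ∈ ℝ_{≥0} = Φ₀(K)`, with `Div = x`; and `Div(φ) ≤ Div(φ')` for two
co-angular pre-steps `φ = (g, 1, c) : A → B`, `φ' = (g', 1, c') : A → B'` is exactly the radial
condition for the comparison arrow `(g⁻¹ g', 1, g(c' c⁻¹)) : B → B'`, whose angular condition is
automatic (with equality, so that it is again a co-angular pre-step).  Contents (all PROVED):
`iii_d_under_full`, `iii_d_under_surj`, `iii_d_over_full`, `iii_d_over_surj`.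
-/

namespace Literature.AlgebraicGeometry.Frobenioids

open CategoryTheory Set Function Topology
open scoped Pointwise

noncomputable section

namespace ArchFrd

namespace C0

variable {X Y Z : C0}

/-! ### Small tools -/

/-- `Div(φ) ∣ Div(φ')` in `ℝ_{≥0}` means `ratio(φ) ≤ ratio(φ')`.
[cite: MochizukiFrdII2008, Ex 3.3 (i) p.28] -/
theorem ratio_le_of_div_dvd {X' Y' : C0} (φ : X ⟶ Y) (φ' : X' ⟶ Y') (h : div φ ∣ div φ') :
    ratio φ ≤ ratio φ' := by
  obtain ⟨k, hk⟩ := h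
  have h1 : ((Multiplicative.toAdd (div φ) : NNReal) : ℝ) ≤
      ((Multiplicative.toAdd (div φ') : NNReal) : ℝ) := by
    rw [hk, toAdd_mul, NNReal.coe_add]
    exact le_add_of_nonneg_right (NNReal.coe_nonneg _)
  rw [coe_toAdd_div, coe_toAdd_div] at h1
  exact (Real.log_le_log_iff (ratio_pos φ) (ratio_pos φ')).1 h1

/-- An object base-isomorphic to a real object is real (`Hom(Spec ℝ, Spec ℂ) = ∅`).
[cite: MochizukiFrdII2008, Def 3.1 (i) p.23] -/
theorem isRealObj_of_isIso_base (ψ : Y ⟶ X) [IsIso (Base ψ)] (hX : X.IsRealObj) : Y.IsRealObj := by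
  rcases D0.isReal_or_isComplex Y.base with h | h
  · exact h
  · have f := inv (Base ψ)
    rw [show X.base = D0.real from hX, show Y.base = D0.complex from h] at f
    exact (D0.isEmpty_hom_real_complex.false f).elim

/-! ### Def. 1.3 (iii)(d): the coslice `A ↓ co-angular pre-steps → Φ₀(A)` -/

/-- **Def. 1.3 (iii)(d), under `A`, fullness, for `C₀`**: if `φ = (g, 1, c) : A → B` and
`φ' = (g', 1, c') : A → B'` are co-angular pre-steps with `Div(φ) ≤ Div(φ')`, then
`(g⁻¹ g', 1, g(c' c⁻¹)) : B → B'` is a co-angular pre-step with `f ∘ φ = φ'`.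
[cite: MochizukiFrdII2008, Ex 3.3 (ii) p.28] -/
theorem iii_d_under_full {A B B' : C0} (φ : A ⟶ B) (φ' : A ⟶ B')
    (hφ : PreFrobenioid.IsCoAngularPreStep toElem φ) (hφ' : PreFrobenioid.IsCoAngularPreStep toElem φ')
    (hdvd : div φ ∣ div φ') :
    ∃ f : B ⟶ B', PreFrobenioid.IsCoAngularPreStep toElem f ∧ φ ≫ f = φ' := by
  have hdφ : degFr φ = 1 := hφ.2.1
  have hdφ' : degFr φ' = 1 := hφ'.2.1
  haveI : IsIso (Base φ) := hφ.2.2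
  haveI : IsIso (Base φ') := hφ'.2.2
  -- the angular condition, with equality
  have E : unitPart ℂ ((Base φ).act (scalar φ' * (scalar φ)⁻¹)) • B.region.dir =
      (fun z : normOneSubgroup ℂ => unitPart ℂ ((inv (Base φ) ≫ Base φ').act (z : ℂˣ))) ''
        B'.region.dir := by
    rcases D0.isReal_or_isComplex A.base with hA | hA
    · rw [show B'.region.dir = univ from isNaivelyIsotropic_of_isRealObj (isRealObj_of_hom φ' hA),
        twist_image_univ,
        show B.region.dir = univ from isNaivelyIsotropic_of_isRealObj (isRealObj_of_hom φ hA),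
        Set.smul_set_univ]
    · have hφn := isNaivelyCoAngular_of_isCoAngular φ hφ.1 hA
      have hφ'n := isNaivelyCoAngular_of_isCoAngular φ' hφ'.1 hA
      rw [image_unitPart_homImage, image_unitPart_pullRegion, hdφ, PNat.one_coe, pow_one] at hφn
      rw [image_unitPart_homImage, hdφ', PNat.one_coe, pow_one] at hφ'n
      -- `τ_g(B_A) = τ_g(u_c)⁻¹ · B_B`
      have H2 := congrArg
        (Set.image fun z : normOneSubgroup ℂ => unitPart ℂ ((Base φ).act (z : ℂˣ))) hφn
      rw [twist_image_smul, twist_image_twist_image] at H2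
      have H3 := (eq_inv_smul_iff.mpr H2)
      rw [← image_unitPart_pullRegion, pullRegion_comp, image_unitPart_act_image, D0.act_inv (Base φ),
        ← hφ'n, twist_image_smul, H3, smul_smul, map_mul, unitPart_mul, map_inv, unitPart_inv,
        unitPart_galAct _ (scalar φ'), unitPart_galAct _ (scalar φ)]
  -- the radial condition
  have htip : ‖(scalar φ' : ℂ)‖ * ‖(scalar φ : ℂ)‖⁻¹ * B.tip ≤ B'.tip := by
    have h := ratio_le_of_div_dvd φ φ' hdvd
    unfold ratio at h
    rw [hdφ, hdφ', PNat.one_coe, pow_one] at h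
    have hA := A.tip_pos
    have h1 : 0 < ‖(scalar φ : ℂ)‖ := norm_pos_iff.mpr (scalar φ).ne_zero
    have h2 : 0 < ‖(scalar φ' : ℂ)‖ := norm_pos_iff.mpr (scalar φ').ne_zero
    rw [div_le_div_iff₀ (mul_pos h1 hA) (mul_pos h2 hA)] at h
    have key : ‖(scalar φ' : ℂ)‖ * B.tip * A.tip ≤ B'.tip * ‖(scalar φ : ℂ)‖ * A.tip := by
      calc ‖(scalar φ' : ℂ)‖ * B.tip * A.tip = B.tip * (‖(scalar φ' : ℂ)‖ * A.tip) := by ring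
        _ ≤ B'.tip * (‖(scalar φ : ℂ)‖ * A.tip) := h
        _ = B'.tip * ‖(scalar φ : ℂ)‖ * A.tip := by ring
    rw [mul_right_comm, ← div_eq_mul_inv, div_le_iff₀ h1]
    exact le_of_mul_le_mul_right key hA
  -- the arrow
  obtain ⟨A'', hA''c, hA''t, hA''d, -⟩ := exists_pulledRegion B' (inv (Base φ) ≫ Base φ')
  have hmem : (Base φ).act (scalar φ' * (scalar φ)⁻¹) ∈ D0.scalars B.base := by
    rw [← D0.act_inv (Base φ)]
    exact act_mem_scalars _ (mul_mem φ'.scalar_mem (inv_mem φ.scalar_mem))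
  obtain ⟨f, hfb, hfd, hfc⟩ := exists_hom B B' (inv (Base φ) ≫ Base φ') 1 hmem hA''c
    (by rw [PNat.one_coe, pow_one, hA''d]; exact E.le)
    (by
      rw [PNat.one_coe, pow_one, hA''t, ← tip_eq, D0.norm_galAct, Units.val_mul, norm_mul,
        Units.val_inv_eq_inv_val, norm_inv]
      exact htip)
  refine ⟨f, ⟨?_, hfd, ?_⟩, hom_ext ?_ ?_ ?_⟩
  · refine isCoAngular_of_isNaivelyCoAngular f fun _ => ?_
    rw [image_unitPart_homImage, image_unitPart_pullRegion, hfc, hfd, PNat.one_coe, pow_one, hfb]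
    exact E
  · rw [isBaseIso_iff, hfb]
    infer_instance
  · rw [base_comp', hfb, IsIso.hom_inv_id_assoc]
  · rw [degFr_comp', hfd, hdφ, hdφ', mul_one]
  · rw [scalar_comp', hfc, hfd, PNat.one_coe, pow_one, D0.galAct_galAct, inv_mul_cancel_right]

/-- **Def. 1.3 (iii)(d), under `A`, essential surjectivity, for `C₀`**: every `x ∈ ℝ_{≥0} = Φ₀(K)` is
`Div` of the co-angular pre-step `(𝟙, 1, 1) : (K, B, λ) → (K, B, λ e^x)`.
[cite: MochizukiFrdII2008, Ex 3.3 (ii) p.28] -/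
theorem iii_d_under_surj (A : C0) (x : Multiplicative NNReal) :
    ∃ (B : C0) (φ : A ⟶ B), PreFrobenioid.IsCoAngularPreStep toElem φ ∧ div φ = x := by
  obtain ⟨R, hRd, hRt⟩ := exists_angularRegion A.region.isOpen_dir A.region.isConnected_dir
    (A.region.tip * ⟨Real.exp ((Multiplicative.toAdd x : NNReal) : ℝ), Real.exp_pos _⟩)
  have hR : A.base = D0.real → R.IsIsotropic := fun h => by
    change R.dir = univ
    rw [hRd]
    exact A.isIsotropic_of_isReal h
  let B : C0 := ⟨A.base, R, hR⟩
  obtain ⟨A', hA'c, hA't, hA'd, -⟩ := exists_pulledRegion B (𝟙 A.base)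
  rw [twist_id_image] at hA'd
  obtain ⟨φ, hφb, hφd, hφc⟩ := exists_hom A B (𝟙 A.base) 1 (one_mem _) hA'c
    (by rw [hA'd, unitPart_one, one_smul, PNat.one_coe, pow_one]; exact hRd.symm.subset)
    (by
      rw [hA't, Units.val_one, norm_one, one_mul, PNat.one_coe, pow_one]
      change A.tip ≤ ((R.tip : PosReal) : ℝ)
      rw [hRt, Positive.val_mul, tip_eq]
      exact le_mul_of_one_le_right (le_of_lt A.region.tip.2) (Real.one_le_exp (NNReal.coe_nonneg _)))
  refine ⟨B, φ, ⟨?_, hφd, ?_⟩, ?_⟩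
  · refine isCoAngular_of_isNaivelyCoAngular φ fun _ => ?_
    rw [image_unitPart_homImage, image_unitPart_pullRegion, hφc, unitPart_one, one_smul, hφd,
      PNat.one_coe, pow_one, hφb, twist_id_image]
    exact hRd.symm
  · rw [isBaseIso_iff, hφb]
    infer_instance
  · apply Multiplicative.toAdd.injective
    apply NNReal.eq
    rw [coe_toAdd_div]
    unfold ratio
    rw [hφc, hφd, Units.val_one, norm_one, one_mul, PNat.one_coe, pow_one]
    change Real.log (((R.tip : PosReal) : ℝ) / A.tip) = _
    rw [hRt, Positive.val_mul, ← tip_eq]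
    change Real.log (A.tip * Real.exp _ / A.tip) = _
    rw [mul_div_cancel_left₀ _ A.tip_pos.ne', Real.log_exp]

/-! ### Def. 1.3 (iii)(d): the slice `co-angular pre-steps ↓ A → Φ₀(A)` -/

/-- **Def. 1.3 (iii)(d), over `A`, fullness, for `C₀`**: if `ψ = (p, 1, c) : B → A` and
`ψ' = (p', 1, c') : B' → A` are co-angular pre-steps with `Div(ψ') ≤ Div(ψ)` (the pull-backs
`(ψ^*)⁻¹` of `Φ₀` being identities), then `(p p'⁻¹, 1, c · (p p'⁻¹)(c')⁻¹) : B → B'` is a co-angular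
pre-step with `ψ' ∘ g = ψ`. [cite: MochizukiFrdII2008, Ex 3.3 (ii) p.28] -/
theorem iii_d_over_full {A B B' : C0} (ψ : B ⟶ A) (ψ' : B' ⟶ A)
    (hψ : PreFrobenioid.IsCoAngularPreStep toElem ψ) (hψ' : PreFrobenioid.IsCoAngularPreStep toElem ψ')
    (hdvd : div ψ' ∣ div ψ) :
    ∃ g : B ⟶ B', PreFrobenioid.IsCoAngularPreStep toElem g ∧ g ≫ ψ' = ψ := by
  have hdψ : degFr ψ = 1 := hψ.2.1
  have hdψ' : degFr ψ' = 1 := hψ'.2.1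
  haveI : IsIso (Base ψ) := hψ.2.2
  haveI : IsIso (Base ψ') := hψ'.2.2
  -- the scalar `e = c · q(c')⁻¹`, `q = p p'⁻¹`
  have hq : (Base ψ ≫ inv (Base ψ')).act (scalar ψ') = (Base ψ).act ((Base ψ').act (scalar ψ')) := by
    rw [act_comp_of_mem _ _ ψ'.scalar_mem, D0.act_inv]
  -- the angular condition, with equality
  have E : unitPart ℂ (scalar ψ * ((Base ψ ≫ inv (Base ψ')).act (scalar ψ'))⁻¹) • B.region.dir =
      (fun z : normOneSubgroup ℂ => unitPart ℂ ((Base ψ ≫ inv (Base ψ')).act (z : ℂˣ))) ''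
        B'.region.dir := by
    rcases D0.isReal_or_isComplex B.base with hB | hB
    · have hA : A.IsRealObj := isRealObj_of_hom ψ hB
      rw [show B'.region.dir = univ from isNaivelyIsotropic_of_isRealObj (isRealObj_of_isIso_base ψ' hA),
        twist_image_univ, show B.region.dir = univ from isNaivelyIsotropic_of_isRealObj hB,
        Set.smul_set_univ]
    · have hB' : B'.base.IsComplex := by
        rcases D0.isReal_or_isComplex B'.base with h | h
        · exact absurd (isRealObj_of_isIso_base ψ (isRealObj_of_hom ψ' h)) (by
            change ¬ (B.base = D0.real); rw [show B.base = D0.complex from hB]; decide)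
        · exact h
      have hψn := isNaivelyCoAngular_of_isCoAngular ψ hψ.1 hB
      have hψ'n := isNaivelyCoAngular_of_isCoAngular ψ' hψ'.1 hB'
      rw [image_unitPart_homImage, image_unitPart_pullRegion, hdψ, PNat.one_coe, pow_one] at hψn
      rw [image_unitPart_homImage, image_unitPart_pullRegion, hdψ', PNat.one_coe, pow_one] at hψ'n
      -- `τ_{p'}(B_{B'}) = τ_{p'}(u_{c'})⁻¹ · B_A`
      have H2 := congrArg
        (Set.image fun z : normOneSubgroup ℂ => unitPart ℂ ((Base ψ').act (z : ℂˣ))) hψ'n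
      rw [twist_image_smul, twist_image_twist_image] at H2
      have H3 := (eq_inv_smul_iff.mpr H2)
      rw [← image_unitPart_pullRegion, pullRegion_comp, image_unitPart_act_image,
        image_unitPart_pullRegion, D0.act_inv (Base ψ'), H3, twist_image_smul, ← hψn, smul_smul,
        hq, unitPart_mul, unitPart_inv, unitPart_galAct _ ((Base ψ').act (scalar ψ')),
        unitPart_galAct _ (scalar ψ'), mul_comm, Subgroup.coe_inv, map_inv, unitPart_inv]
  -- the radial condition
  have htip : ‖(scalar ψ : ℂ)‖ * ‖(scalar ψ' : ℂ)‖⁻¹ * B.tip ≤ B'.tip := by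
    have h := ratio_le_of_div_dvd ψ' ψ hdvd
    unfold ratio at h
    rw [hdψ, hdψ', PNat.one_coe, pow_one, pow_one] at h
    have hA := A.tip_pos
    have hBt := B.tip_pos
    have hB't := B'.tip_pos
    have h1 : 0 < ‖(scalar ψ : ℂ)‖ := norm_pos_iff.mpr (scalar ψ).ne_zero
    have h2 : 0 < ‖(scalar ψ' : ℂ)‖ := norm_pos_iff.mpr (scalar ψ').ne_zero
    rw [div_le_div_iff₀ (mul_pos h2 hB't) (mul_pos h1 hBt)] at h
    have key : ‖(scalar ψ : ℂ)‖ * B.tip * A.tip ≤ B'.tip * ‖(scalar ψ' : ℂ)‖ * A.tip := by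
      calc ‖(scalar ψ : ℂ)‖ * B.tip * A.tip = A.tip * (‖(scalar ψ : ℂ)‖ * B.tip) := by ring
        _ ≤ A.tip * (‖(scalar ψ' : ℂ)‖ * B'.tip) := h
        _ = B'.tip * ‖(scalar ψ' : ℂ)‖ * A.tip := by ring
    rw [mul_right_comm, ← div_eq_mul_inv, div_le_iff₀ h2]
    exact le_of_mul_le_mul_right key hA
  -- the arrow
  obtain ⟨A'', hA''c, hA''t, hA''d, -⟩ := exists_pulledRegion B' (Base ψ ≫ inv (Base ψ'))
  have hmem : scalar ψ * ((Base ψ ≫ inv (Base ψ')).act (scalar ψ'))⁻¹ ∈ D0.scalars B.base :=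
    mul_mem ψ.scalar_mem (inv_mem (act_mem_scalars _ ψ'.scalar_mem))
  obtain ⟨g, hgb, hgd, hgc⟩ := exists_hom B B' (Base ψ ≫ inv (Base ψ')) 1 hmem hA''c
    (by rw [PNat.one_coe, pow_one, hA''d]; exact E.le)
    (by
      rw [PNat.one_coe, pow_one, hA''t, ← tip_eq, Units.val_mul, norm_mul, Units.val_inv_eq_inv_val,
        norm_inv, D0.norm_galAct]
      exact htip)
  refine ⟨g, ⟨?_, hgd, ?_⟩, hom_ext ?_ ?_ ?_⟩
  · refine isCoAngular_of_isNaivelyCoAngular g fun _ => ?_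
    rw [image_unitPart_homImage, image_unitPart_pullRegion, hgc, hgd, PNat.one_coe, pow_one, hgb]
    exact E
  · rw [isBaseIso_iff, hgb]
    infer_instance
  · rw [base_comp', hgb, Category.assoc, IsIso.inv_hom_id, Category.comp_id]
  · rw [degFr_comp', hgd, hdψ, hdψ', mul_one]
  · rw [scalar_comp', hgc, hgb, hdψ', PNat.one_coe, pow_one, mul_comm (scalar ψ), ← mul_assoc,
      mul_inv_cancel, one_mul]

/-- **Def. 1.3 (iii)(d), over `A`, essential surjectivity, for `C₀`**: every `x ∈ ℝ_{≥0} = Φ₀(K)` is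
`(ψ^*)⁻¹ Div(ψ) = Div(ψ)` of the co-angular pre-step `(𝟙, 1, 1) : (K, B, λ e^{-x}) → (K, B, λ)`.
[cite: MochizukiFrdII2008, Ex 3.3 (ii) p.28] -/
theorem iii_d_over_surj (A : C0) (x : Multiplicative NNReal) :
    ∃ (B : C0) (ψ : B ⟶ A) (h : PreFrobenioid.IsCoAngularPreStep toElem ψ),
      PreFrobenioid.invDiv toElem ψ h.2.2 = x := by
  obtain ⟨R, hRd, hRt⟩ := exists_angularRegion A.region.isOpen_dir A.region.isConnected_dir
    (A.region.tip * ⟨Real.exp (-((Multiplicative.toAdd x : NNReal) : ℝ)), Real.exp_pos _⟩)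
  have hR : A.base = D0.real → R.IsIsotropic := fun h => by
    change R.dir = univ
    rw [hRd]
    exact A.isIsotropic_of_isReal h
  let B : C0 := ⟨A.base, R, hR⟩
  obtain ⟨A', hA'c, hA't, hA'd, -⟩ := exists_pulledRegion A (𝟙 A.base)
  rw [twist_id_image] at hA'd
  obtain ⟨ψ, hψb, hψd, hψc⟩ := exists_hom B A (𝟙 A.base) 1 (one_mem _) hA'c
    (by rw [hA'd, unitPart_one, one_smul, PNat.one_coe, pow_one]; exact hRd.subset)
    (by
      rw [hA't, Units.val_one, norm_one, one_mul, PNat.one_coe, pow_one, ← tip_eq]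
      change ((R.tip : PosReal) : ℝ) ≤ A.tip
      rw [hRt, Positive.val_mul, tip_eq]
      exact mul_le_of_le_one_right (le_of_lt A.region.tip.2)
        (Real.exp_le_one_iff.mpr (neg_nonpos.mpr (NNReal.coe_nonneg _))))
  have hψ : PreFrobenioid.IsCoAngularPreStep toElem ψ := by
    refine ⟨?_, hψd, ?_⟩
    · refine isCoAngular_of_isNaivelyCoAngular ψ fun _ => ?_
      rw [image_unitPart_homImage, image_unitPart_pullRegion, hψc, unitPart_one, one_smul, hψd,
        PNat.one_coe, pow_one, hψb, twist_id_image]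
      exact hRd
    · rw [isBaseIso_iff, hψb]
      infer_instance
  refine ⟨B, ψ, hψ, ?_⟩
  change div ψ = x
  apply Multiplicative.toAdd.injective
  apply NNReal.eq
  rw [coe_toAdd_div]
  unfold ratio
  rw [hψc, hψd, Units.val_one, norm_one, one_mul, PNat.one_coe, pow_one]
  change Real.log (A.tip / ((R.tip : PosReal) : ℝ)) = _
  rw [hRt, Positive.val_mul, ← tip_eq]
  change Real.log (A.tip / (A.tip * Real.exp _)) = _
  rw [← div_div, div_self A.tip_pos.ne', one_div, ← Real.exp_neg, neg_neg, Real.log_exp]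

end C0

end ArchFrd

end

end Literature.AlgebraicGeometry.Frobenioids
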